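import Literature.AlgebraicGeometry.Motives.JacobianStepOneTransport
import Literature.AlgebraicGeometry.Motives.JacobianStepOneOpenTransport
import Literature.AlgebraicGeometry.Motives.JacobianStepOneMultiplicity
import Literature.AlgebraicGeometry.Motives.JacobianBrillNoetherLocusSymmetric
import Literature.AlgebraicGeometry.Motives.JacobianThetaDivisorSubscheme
import Literature.AlgebraicGeometry.Motives.JacobianThetaDivisorDimPos
import Literature.AlgebraicGeometry.Motives.AbelianVarietyPullbackWeilDivInverseOfTranslate
import Literature.AlgebraicGeometry.Motives.AbelianVarietyKThetaOfClassPullbackInjective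
import Literature.AlgebraicGeometry.Motives.VarietiesProperProofs
import Literature.AlgebraicGeometry.Motives.CartierDivisorReducedMultiplicityOne
import Literature.AlgebraicGeometry.Motives.AbelTheorem
import HarnessLib

/-!
# `K(Θ)(ℂ) = ⊥` for a Riemann theta divisor of multiplicity one (Step I of the G4 road, re-keyed without a polarisation word)

Layer `Literature/AlgebraicGeometry/Motives`, namespaces `Literature.AlgebraicGeometry.Motives.{CartierDivisor, AbelianVariety, Jacobian}`.
THEOREMS ONLY; no definition, no named fact, no instance.  Cell `hodgecm-mathlib` (D-0151), brick (V7-b) of G5 (row VI-7 ★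
`Jacobian.riemann_brillNoetherLocus_isPrincipalPolarizationDivisor`): the ★ Step-I transport of the G4 road
(`Motives/JacobianStepOneTransport`, consumer letter (3a′)) carries the hypothesis «`Θ` is a principal polarisation divisor» at exactly three
tokens — stability under translation pull-back, the integrality of `Z(Θ₀)` fed to Milne's incidence, and «`(−1)^*Θ₀ ≈ t_κ^*Θ₀`» (two principal
polarisation divisors with the same irreducible support are the same divisor).  All three only use that `Θ` is NOT A PROPER MULTIPLE of an
effective divisor.  This file re-keys the transport on that hypothesis,

  `HONE(Θ) : ∀ E ≥ 0, ∀ m > 0, Θ ≈ m • E ⟹ m = 1`  (multiplicity one),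

which holds for principal polarisation divisors (★ `AbelianVariety.eq_one_of_isPrincipalPolarizationDivisor_smul`) AND for the prime divisor
`[W̃_{g−1}]` by construction — so that Lange's Cor. 4.4.5 «`(α_c^*)⁻¹ = −φ_Θ`», read on complex points through ★
`AbelianVariety.aj_classPullback_weilDiv_eq_inv_of_translate`, yields **`K(Θ)(ℂ) = {x | t_x^*Θ ∼ Θ} = ⊥`** (★
`AbelianVariety.KTheta_eq_bot_of_aj_classPullback_weilDiv_eq_inv`: the «`φ_Θ` is injective» half of Riemann's theorem
[Milne1986JacobianVarieties, Thm. 6.6], [Lange2023AbelianVarietiesComplex, §4.2.1 Thm. 4.2.3 / Cor. 4.4.5]) for every Riemann theta divisor of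
multiplicity one, with NO polarisation hypothesis — modulo ABEL at the base point (`hA`, ★ `Motives/AbelTheorem`), every other leaf of
Step I being ★ and CALLED here: (OPEN+TUPLE) ★ `exists_opens_general_abelSum_of_isSmoothProjective`, multiplicity `≤ 1` of the honest
pull-backs ★ `exists_open_ordAt_pullbackAvoiding_shear_le_one`, (M″) ★ `exists_open_ajSum_classPullback_shear_of_leaves`, (SYM) ★
`exists_preimage_neg_brillNoetherLocus_eq`.

## Contents
* §1 multiplicity one: stable under pull-back along an automorphism (`CartierDivisor.forall_eq_one_pullback_of_comp_eq_id`); two effective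
  divisors of multiplicity one with the same irreducible support on an abelian variety are the same divisor
  (`AbelianVariety.sameDivisor_of_support_eq_of_forall_eq_one`); multiplicity one with irreducible support ⇒ `Z(Θ)` integral
  (`CartierDivisor.IsEffective.isIntegral_subscheme_idealSheaf_of_forall_isEffective_eq_one`, Hartshorne II.6.11).
* §2 the transport, re-keyed: `Jacobian.exists_open_ajSum_classPullback_translate_of_forall_eq_one` — for a Riemann theta divisor `Θ` of
  multiplicity one, `aj_c(α_c^♮(t_x^*Θ)) = κ′ · x⁻¹` on a dense open set of `x` (Lange Lemma 4.4.4 Step I / Milne Lemma 6.7).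
* §3 `Jacobian.KTheta_eq_bot_of_isRiemannThetaDivisor_of_forall_eq_one` — `K(Θ)(ℂ) = ⊥`.
* §4 the letter `stub_V7b` of G5 verbatim (`Z(Θ)` integral, ABEL ★ `Jacobian.ajSum_congr_linEquiv`):
  `Jacobian.exists_open_ajSum_classPullback_translate_of_isIntegral`, `Jacobian.KTheta_eq_bot_of_isRiemannThetaDivisor_of_isIntegral`.

## References
* [Lange2023AbelianVarietiesComplex] H. Lange, *Abelian Varieties over the Complex Numbers* (2023), §4.4.2 Lemma 4.4.4 (p. 224) and
  Cor. 4.4.5; §4.2.1 Lemma 4.2.1 (ii), Thm. 4.2.3 and Cor. 4.2.4.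
* [Milne1986JacobianVarieties] J. S. Milne, *Jacobian Varieties*, in Cornell–Silverman (eds.), *Arithmetic Geometry* (1986), §6 Thm. 6.6,
  Lemma 6.7 (p. 187) and Lemma 6.9.
* [Hartshorne1977] R. Hartshorne, *Algebraic Geometry* (1977), II.6 Prop. 6.11 and Remark 6.11.2 (pp. 141–142).
* [GortzWedhorn2020] U. Görtz, T. Wedhorn, *Algebraic Geometry I*, 2nd ed. (2020), Def./Prop. 11.49–11.50 (pull-back of divisors).
-/

set_option autoImplicit false

noncomputable section

universe u

open CategoryTheory CategoryTheory.Limits AlgebraicGeometry TopologicalSpace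
open Literature.AlgebraicGeometry.Resolution Literature.AlgebraicGeometry.Morphisms
open scoped MonObj

namespace Literature.AlgebraicGeometry.Motives

/-! ## §1 Multiplicity one -/

namespace CartierDivisor

open RatFn

variable {X : Scheme.{u}} [IsIntegral X]

/-- **Multiplicity one is stable under pull-back along an automorphism**: if `ψ ≫ φ = 𝟙` and `D ≈ m • E ⟹ m = 1` for all effective `E`,
then the same holds for `φ^* D` — pull `φ^*D ≈ m • E` back along `ψ` to `D ≈ m • ψ^*E` (`g^*` is a homomorphism respecting «same
divisor»). [cite: GortzWedhorn2020, Def. 11.49 and Prop. 11.50] -/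
theorem forall_eq_one_pullback_of_comp_eq_id (D : CartierDivisor X) (φ ψ : X ⟶ X) [IsDominant φ] [IsDominant ψ]
    (hid : ψ ≫ φ = 𝟙 X)
    (hone : ∀ (E : CartierDivisor X) (m : ℕ), E.IsEffective → 0 < m → D.SameDivisor (m • E) → m = 1) :
    ∀ (E : CartierDivisor X) (m : ℕ), E.IsEffective → 0 < m → (D.pullback φ).SameDivisor (m • E) → m = 1 := by
  intro E m hE hm hs
  refine hone (E.pullback ψ) m (hE.pullback ψ) hm ?_
  have h1 : ((D.pullback φ).pullback ψ).SameDivisor ((m • E).pullback ψ) := hs.pullback ψ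
  rw [pullback_smul] at h1
  have h2 : ((D.pullback φ).pullback ψ).SameDivisor D :=
    ((pullback_pullback_sameDivisor (D := D) φ ψ).trans (pullback_congr_sameDivisor (D := D) hid)).trans
      (pullback_id_sameDivisor (D := D))
  exact h2.symm.trans h1

section Regular

variable [IsNoetherian X]

/-- **An effective Cartier divisor of multiplicity one (tested against EFFECTIVE divisors) with irreducible support has ideal sheaf the
prime divisor ideal of its support** (regular integral Noetherian `X`): `D ≈ a • [cl η]`, `a ≥ 1` (★ `exists_sameDivisor_smul_of_support_eq_closure`,
Hartshorne II.6.11) and multiplicity one gives `a = 1`. [cite: Hartshorne1977, II.6 Prop. 6.11 and Remark 6.11.2 (pp. 141–142)] -/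
theorem IsEffective.idealSheaf_eq_primeDivisorIdeal_of_forall_isEffective_eq_one (hX : Scheme.IsRegular X) {D : CartierDivisor X}
    (hD : D.IsEffective) {ξ : X} (hξ : (D.nonvanishing 1)ᶜ = closure {ξ})
    (hone : ∀ (E : CartierDivisor X) (m : ℕ), E.IsEffective → 0 < m → D.SameDivisor (m • E) → m = 1) :
    hD.idealSheaf = primeDivisorIdeal ξ := by
  obtain ⟨h1, a, ha, hDa⟩ := hD.exists_sameDivisor_smul_of_support_eq_closure hX hξ
  have ha1 : a = 1 := hone _ a (isEffective_ofIsEffectiveCartier _ _) ha hDa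
  subst ha1
  rw [one_smul] at hDa
  exact hDa.idealSheaf_eq_of_ofIsEffectiveCartier hD _

/-- **The closed subscheme of an effective divisor of multiplicity one with irreducible support is integral** (reduced induced structure on
`cl{ξ}`). [cite: Hartshorne1977, II.6 Prop. 6.11 and Remark 6.11.2 (pp. 141–142)] [cite: GortzWedhorn2020, Prop. 3.27 (p. 79)] -/
theorem IsEffective.isIntegral_subscheme_idealSheaf_of_forall_isEffective_eq_one (hX : Scheme.IsRegular X) {D : CartierDivisor X}
    (hD : D.IsEffective) {ξ : X} (hξ : (D.nonvanishing 1)ᶜ = closure {ξ})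
    (hone : ∀ (E : CartierDivisor X) (m : ℕ), E.IsEffective → 0 < m → D.SameDivisor (m • E) → m = 1) :
    IsIntegral hD.idealSheaf.subscheme := by
  rw [hD.idealSheaf_eq_primeDivisorIdeal_of_forall_isEffective_eq_one hX hξ hone]
  refine isIntegral_subscheme _ (le_antisymm (fun U => ?_) (Scheme.IdealSheafData.le_radical _)) ?_
  · rw [primeDivisorIdeal, Scheme.IdealSheafData.radical_ideal, Scheme.IdealSheafData.vanishingIdeal_ideal]
    exact (PrimeSpectrum.isRadical_vanishingIdeal _).radical_le_iff.mpr le_rfl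
  · rw [coe_support_primeDivisorIdeal]
    exact isIrreducible_singleton.closure

end Regular

end CartierDivisor

namespace AbelianVariety

/-- **Two effective divisors of multiplicity one with the same irreducible support on an abelian variety are the same divisor**: each is
`mᵢ • [Z]` for the prime divisor `[Z]` of the common support (★ `exists_sameDivisor_smul_of_support_eq_closure`; `A` is regular, ★
`isRegularLocalRing_stalk`), and multiplicity one forces `mᵢ = 1`. [cite: Hartshorne1977, II.6 Prop. 6.11 and Remark 6.11.2 (pp. 141–142)]
[cite: Lange2023AbelianVarietiesComplex, §4.2.1 Cor. 4.2.4] -/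
theorem sameDivisor_of_support_eq_of_forall_eq_one {k : Type u} [Field k] (A : AbelianVariety k) {E₁ E₂ : CartierDivisor A.X.left}
    (h₁ : E₁.IsEffective) (h₂ : E₂.IsEffective)
    (hone₁ : ∀ (E : CartierDivisor A.X.left) (m : ℕ), E.IsEffective → 0 < m → E₁.SameDivisor (m • E) → m = 1)
    (hone₂ : ∀ (E : CartierDivisor A.X.left) (m : ℕ), E.IsEffective → 0 < m → E₂.SameDivisor (m • E) → m = 1)
    (hsupp : (E₁.nonvanishing 1)ᶜ = (E₂.nonvanishing 1)ᶜ) (hirr : IsIrreducible (E₁.nonvanishing 1)ᶜ) : E₁.SameDivisor E₂ := by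
  haveI := A.isNoetherian_left
  have hX : Scheme.IsRegular A.X.left := fun x => A.isRegularLocalRing_stalk x
  have hcl : IsClosed (E₁.nonvanishing 1)ᶜ := (E₁.isOpen_nonvanishing 1).isClosed_compl
  have hη : (E₁.nonvanishing 1)ᶜ = closure {hirr.genericPoint} := (hirr.closure_genericPoint hcl).symm
  obtain ⟨hc1, m₁, hm₁, hE₁⟩ := h₁.exists_sameDivisor_smul_of_support_eq_closure hX hη
  obtain ⟨hc1', m₂, hm₂, hE₂⟩ := h₂.exists_sameDivisor_smul_of_support_eq_closure hX (hsupp.symm.trans hη)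
  have e₁ : m₁ = 1 := hone₁ _ m₁ (CartierDivisor.isEffective_ofIsEffectiveCartier _ _) hm₁ hE₁
  have e₂ : m₂ = 1 := hone₂ _ m₂ (CartierDivisor.isEffective_ofIsEffectiveCartier _ _) hm₂ hE₂
  subst e₁; subst e₂
  rw [CartierDivisor.one_smul] at hE₁ hE₂
  exact hE₁.trans hE₂.symm

/-- A principal polarisation divisor on a complex abelian variety of positive dimension has multiplicity one (★
`eq_one_of_isPrincipalPolarizationDivisor_smul`) — so the re-keyed Step I below contains the ★ transport.
[cite: Lange2023AbelianVarietiesComplex, §4.1.2 Prop. 4.1.2 and §4.2.1 Cor. 4.2.4] -/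
theorem IsPrincipalPolarizationDivisor.forall_isEffective_eq_one (A : AbelianVariety ℂ) (hA : 1 ≤ A.dim) {Θ : CartierDivisor A.X.left}
    (h : A.IsPrincipalPolarizationDivisor Θ) :
    ∀ (E : CartierDivisor A.X.left) (m : ℕ), E.IsEffective → 0 < m → Θ.SameDivisor (m • E) → m = 1 :=
  fun E _ _ hm hs => A.eq_one_of_isPrincipalPolarizationDivisor_smul hA E hm.ne' (h.congr_sameDivisor hs)

end AbelianVariety

/-! ## §2 Step I re-keyed on multiplicity one -/

namespace Jacobian

variable {C : SchemeOver ℂ} [IsIntegral C.left] [IsLocallyNoetherian C.left]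

omit [IsIntegral C.left] [IsLocallyNoetherian C.left] in
/-- **(SYM) on DIVISORS, multiplicity-one form**: for an effective `Θ₀` of multiplicity one with support EXACTLY `W̃_{dim J−1}(c)` and `κ`
with `(−1)⁻¹ W̃(c) = t_κ⁻¹ W̃(c)`, `(−1)^*Θ₀ ≈ t_κ^*Θ₀` — both pull-backs are effective of multiplicity one (§1) with the same irreducible
support. [cite: Milne1986JacobianVarieties, §6 Lemma 6.7 (Θ⁻ = (−1)^*Θ)] [cite: Lange2023AbelianVarietiesComplex, §4.2.1 Cor. 4.2.4] -/
theorem pullback_negOne_sameDivisor_pullback_translation_of_forall_eq_one (hC : IsSmoothProjective 1 C) (𝒥 : Jacobian C)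
    (c : AlgPoints C ℂ) {Θ₀ : CartierDivisor 𝒥.J.X.left} (h0 : Θ₀.IsEffective)
    (hsupp : (Θ₀.nonvanishing 1)ᶜ = 𝒥.brillNoetherLocus c (𝒥.J.dim - 1))
    (hone : ∀ (E : CartierDivisor 𝒥.J.X.left) (m : ℕ), E.IsEffective → 0 < m → Θ₀.SameDivisor (m • E) → m = 1)
    {κ : 𝒥.J.Points ℂ}
    (hκ : (AbelianVariety.Hom.toSchemeHom ((-1 : ℤ) • 𝟙 𝒥.J)).base ⁻¹' 𝒥.brillNoetherLocus c (𝒥.J.dim - 1) =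
      (𝒥.J.translation κ).left.base ⁻¹' 𝒥.brillNoetherLocus c (𝒥.J.dim - 1)) :
    haveI := 𝒥.isDominant_toSchemeHom_negOne
    (Θ₀.pullback (AbelianVariety.Hom.toSchemeHom ((-1 : ℤ) • 𝟙 𝒥.J))).SameDivisor (Θ₀.pullback (𝒥.J.translation κ).left) := by
  haveI := 𝒥.isDominant_toSchemeHom_negOne
  haveI := 𝒥.isIso_negOne_zsmul_id
  haveI := hC.geometricallyIrreducible
  have hs₁ : ((Θ₀.pullback (AbelianVariety.Hom.toSchemeHom ((-1 : ℤ) • 𝟙 𝒥.J))).nonvanishing 1)ᶜ =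
      (𝒥.J.translation κ).left.base ⁻¹' 𝒥.brillNoetherLocus c (𝒥.J.dim - 1) := by
    rw [h0.compl_nonvanishing_one_pullback, hsupp, hκ]
  have hs₂ : ((Θ₀.pullback (𝒥.J.translation κ).left).nonvanishing 1)ᶜ =
      (𝒥.J.translation κ).left.base ⁻¹' 𝒥.brillNoetherLocus c (𝒥.J.dim - 1) := by
    rw [h0.compl_nonvanishing_one_pullback, hsupp]
  have hirr : IsIrreducible ((Θ₀.pullback (AbelianVariety.Hom.toSchemeHom ((-1 : ℤ) • 𝟙 𝒥.J))).nonvanishing 1)ᶜ := by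
    rw [hs₁, ← inv_inv κ, ← 𝒥.image_translation_eq_preimage κ⁻¹]
    exact 𝒥.isIrreducible_image_translation_brillNoetherLocus c _ κ⁻¹
  -- multiplicity one of the two pull-backs: `(−1) ≫ (−1) = 𝟙`, `t_{κ⁻¹} ≫ t_κ = 𝟙`
  have hneg : AbelianVariety.Hom.toSchemeHom ((-1 : ℤ) • 𝟙 𝒥.J) ≫ AbelianVariety.Hom.toSchemeHom ((-1 : ℤ) • 𝟙 𝒥.J) =
      𝟙 𝒥.J.X.left := by
    change AbelianVariety.Hom.toSchemeHom (((-1 : ℤ) • 𝟙 𝒥.J) ≫ ((-1 : ℤ) • 𝟙 𝒥.J)) = _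
    rw [𝒥.negOne_zsmul_id_comp_self]
    rfl
  have htr : (𝒥.J.translation κ⁻¹).left ≫ (𝒥.J.translation κ).left = 𝟙 𝒥.J.X.left := by
    rw [← Over.comp_left, 𝒥.J.translation_inv_comp_translation κ, Over.id_left]
  have hone₁ := Θ₀.forall_eq_one_pullback_of_comp_eq_id (AbelianVariety.Hom.toSchemeHom ((-1 : ℤ) • 𝟙 𝒥.J))
    (AbelianVariety.Hom.toSchemeHom ((-1 : ℤ) • 𝟙 𝒥.J)) hneg hone
  have hone₂ := Θ₀.forall_eq_one_pullback_of_comp_eq_id (𝒥.J.translation κ).left (𝒥.J.translation κ⁻¹).left htr hone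
  exact 𝒥.J.sameDivisor_of_support_eq_of_forall_eq_one (h0.pullback _) (h0.pullback _) hone₁ hone₂ (hs₁.trans hs₂.symm) hirr

/-- **STEP I FOR A RIEMANN THETA DIVISOR OF MULTIPLICITY ONE** (no polarisation word).  For a Jacobian `𝒥` of a smooth projective complex
curve, a base point `c`, ABEL at `c` («`aj_c` is constant on linear equivalence classes»), and a Riemann theta divisor `Θ` with `Θ ≈ m • E ⟹
m = 1` for all effective `E`: **there are a non-empty open `U ⊆ J` and `κ′ ∈ J(ℂ)` with `aj_c(α_c^♮(t_x^*Θ)) = κ′ · x⁻¹` for all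
`x ∈ J(ℂ)` whose point lies in `U`.**  The proof is the ★ transport `exists_open_ajSum_classPullback_translate_of_leaves` with its three uses
of principality replaced by multiplicity one (§1), and with the leaves (OPEN+TUPLE), multiplicity `≤ 1` (fed `Z(Θ₀)` integral from §1),
(M″) and (SYM) CALLED from the tree. [cite: Lange2023AbelianVarietiesComplex, §4.4.2 Lemma 4.4.4 (p. 224)]
[cite: Milne1986JacobianVarieties, §6 Lemma 6.7 (p. 187)] -/
theorem exists_open_ajSum_classPullback_translate_of_forall_eq_one (hC : IsSmoothProjective 1 C) (𝒥 : Jacobian C)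
    (c : AlgPoints C ℂ) (hA : ∀ {E F : CartierDivisor C.left}, E.LinEquiv F → 𝒥.ajSum c E = 𝒥.ajSum c F)
    {Θ : CartierDivisor 𝒥.J.X.left} (h1 : 𝒥.IsRiemannThetaDivisor Θ)
    (hone : ∀ (E : CartierDivisor 𝒥.J.X.left) (m : ℕ), E.IsEffective → 0 < m → Θ.SameDivisor (m • E) → m = 1) :
    ∃ U : 𝒥.J.X.left.Opens, (U : Set 𝒥.J.X.left).Nonempty ∧ ∃ κ' : 𝒥.J.Points ℂ,
      ∀ x : 𝒥.J.Points ℂ, x.pt ∈ U →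
        𝒥.ajSum c ((Θ.pullback (𝒥.J.translation x).left).classPullback (𝒥.abelJacobi c).left) = κ' * x⁻¹ := by
  haveI := 𝒥.isDominant_toSchemeHom_negOne
  haveI := hC.smoothOfRelativeDimension
  haveI : IsProper C.hom := IsSmoothProjective.isProper_holds hC
  have hdim : 1 ≤ 𝒥.J.dim := h1.one_le_dim
  -- Step 1: re-centre the support at `c`: `Θ₀ := t_{x₁}^* Θ`, `supp Θ₀ = W̃(c)`
  obtain ⟨x₁, hsuppΘ⟩ := h1.exists_support_eq_image_translation c
  set Θ₀ : CartierDivisor 𝒥.J.X.left := Θ.pullback (𝒥.J.translation x₁).left with hΘ₀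
  have h0 : Θ₀.IsEffective := h1.isEffective.pullback _
  have hsupp₀ : (Θ₀.nonvanishing 1)ᶜ = 𝒥.brillNoetherLocus c (𝒥.J.dim - 1) := by
    rw [hΘ₀, h1.isEffective.compl_nonvanishing_one_pullback, hsuppΘ, preimage_translation_image_translation]
  have hone₀ : ∀ (E : CartierDivisor 𝒥.J.X.left) (m : ℕ), E.IsEffective → 0 < m → Θ₀.SameDivisor (m • E) → m = 1 :=
    Θ.forall_eq_one_pullback_of_comp_eq_id (𝒥.J.translation x₁).left (𝒥.J.translation x₁⁻¹).left
      (by rw [← Over.comp_left, 𝒥.J.translation_inv_comp_translation x₁, Over.id_left]) hone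
  -- `Θ ≈ t_{x₁⁻¹}^* Θ₀`
  have hΘback : Θ.SameDivisor (Θ₀.pullback (𝒥.J.translation x₁⁻¹).left) := by
    refine CartierDivisor.SameDivisor.symm ?_
    refine (CartierDivisor.pullback_pullback_sameDivisor (D := Θ) _ _).trans ?_
    refine (CartierDivisor.pullback_congr_sameDivisor (D := Θ) (g₂ := 𝟙 _)
      (by rw [← Over.comp_left, 𝒥.J.translation_inv_comp_translation x₁, Over.id_left])).trans ?_
    exact CartierDivisor.pullback_id_sameDivisor (D := Θ)
  -- Step 2: the leaves, CALLED: `Z(Θ₀)` integral (§1), (OPEN+TUPLE), multiplicity `≤ 1`, (M″), (SYM)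
  have hirr₀ : IsIrreducible (Θ₀.nonvanishing 1)ᶜ :=
    (isRiemannThetaDivisor_of_support_eq_brillNoetherLocus h0 c hsupp₀).isIrreducible_support hC
  have hZ : IsIntegral h0.idealSheaf.subscheme := by
    haveI := 𝒥.J.isNoetherian_left
    exact h0.isIntegral_subscheme_idealSheaf_of_forall_isEffective_eq_one (fun x => 𝒥.J.isRegularLocalRing_stalk x)
      (hirr₀.closure_genericPoint (Θ₀.isOpen_nonvanishing 1).isClosed_compl).symm hone₀
  have hopen := exists_opens_general_abelSum_of_isSmoothProjective 𝒥 hC hdim c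
  have hmult := 𝒥.exists_open_ordAt_pullbackAvoiding_shear_le_one c (𝒥.J.dim - 1) h0 hsupp₀ hZ hopen
  obtain ⟨U₀, hU₀, hMU⟩ := 𝒥.exists_open_ajSum_classPullback_shear_of_leaves c (𝒥.J.dim - 1) h0 hsupp₀ hopen hmult
    (fun E F h => hA h)
  obtain ⟨κ, hκ⟩ := exists_preimage_neg_brillNoetherLocus_eq 𝒥 hC c (fun D E h => hA h)
  have hsym := pullback_negOne_sameDivisor_pullback_translation_of_forall_eq_one hC 𝒥 c h0 hsupp₀ hone₀ hκ
  -- Step 3: the open set `U := ((−1) ≫ t_{x₁ κ})⁻¹ U₀` and the constant `κ′ := x₁ κ`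
  set φ : 𝒥.J.X.left ⟶ 𝒥.J.X.left :=
    AbelianVariety.Hom.toSchemeHom ((-1 : ℤ) • 𝟙 𝒥.J) ≫ (𝒥.J.translation (x₁ * κ)).left with hφ
  refine ⟨φ ⁻¹ᵁ U₀, ?_, x₁ * κ, fun x hx => ?_⟩
  · -- non-empty: `φ` is surjective (an automorphism)
    obtain ⟨p, hp⟩ := hU₀
    haveI : IsIso φ := by rw [hφ]; change IsIso ((𝒥.J.zsmulPt (-1)).left ≫ _); infer_instance
    obtain ⟨q, rfl⟩ := (Scheme.homeoOfIso (asIso φ)).surjective p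
    exact ⟨q, hp⟩
  · -- the point `a := x⁻¹ · x₁ · κ` has `a.pt = φ(x.pt) ∈ U₀`
    set a : 𝒥.J.Points ℂ := x⁻¹ * (x₁ * κ) with ha
    have hapt : a.pt = φ.base x.pt := by
      rw [hφ, Scheme.Hom.comp_base, TopCat.coe_comp, Function.comp_apply]
      change a.pt = (𝒥.J.translation (x₁ * κ)).left ((𝒥.J.zsmulPt (-1)).left (AlgPoints.pt x))
      rw [AbelianVariety.zsmulPt_neg_one_apply_pt, AbelianVariety.translation_apply_pt, ha, mul_comm]
    have haU : a.pt ∈ U₀ := by rw [hapt]; exact hx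
    have hmain := hMU a haU
    -- Step 4: both divisors are linearly equivalent to `α_c^♮ (t_{x₁⁻¹ x}^* Θ₀)`
    set ψ : 𝒥.J.X.left ⟶ 𝒥.J.X.left :=
      AbelianVariety.Hom.toSchemeHom ((-1 : ℤ) • 𝟙 𝒥.J) ≫ (𝒥.J.translation a).left with hψ
    haveI : IsDominant ψ := by rw [hψ]; infer_instance
    have hψ' : ψ = (𝒥.J.translation a⁻¹).left ≫ AbelianVariety.Hom.toSchemeHom ((-1 : ℤ) • 𝟙 𝒥.J) :=
      𝒥.toSchemeHom_negOne_comp_translation a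
    haveI : IsDominant ((𝒥.J.translation a⁻¹).left ≫ AbelianVariety.Hom.toSchemeHom ((-1 : ℤ) • 𝟙 𝒥.J)) := inferInstance
    haveI : IsDominant ((𝒥.J.translation a⁻¹).left ≫ (𝒥.J.translation κ).left) := inferInstance
    have hL : (Θ₀.pullback ψ).SameDivisor (Θ₀.pullback (𝒥.J.translation (κ * a⁻¹)).left) := by
      refine (Θ₀.pullback_congr_sameDivisor hψ').trans ?_
      refine (CartierDivisor.pullback_pullback_sameDivisor (D := Θ₀) _ _).symm.trans ?_
      refine (hsym.pullback _).trans ?_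
      refine (CartierDivisor.pullback_pullback_sameDivisor (D := Θ₀) _ _).trans ?_
      exact CartierDivisor.pullback_congr_sameDivisor (D := Θ₀) (by rw [← Over.comp_left, 𝒥.J.translation_comp])
    haveI : IsDominant ((𝒥.J.translation x).left ≫ (𝒥.J.translation x₁⁻¹).left) := inferInstance
    have hR : (Θ.pullback (𝒥.J.translation x).left).SameDivisor (Θ₀.pullback (𝒥.J.translation (x₁⁻¹ * x)).left) := by
      refine (hΘback.pullback _).trans ?_
      refine (CartierDivisor.pullback_pullback_sameDivisor (D := Θ₀) _ _).trans ?_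
      exact CartierDivisor.pullback_congr_sameDivisor (D := Θ₀) (by rw [← Over.comp_left, 𝒥.J.translation_comp])
    have hpar : κ * a⁻¹ = x₁⁻¹ * x := by
      rw [ha, mul_inv_rev, mul_inv_rev, inv_inv]
      rw [← mul_assoc, ← mul_assoc, mul_inv_cancel, one_mul]
    rw [hpar] at hL
    -- Step 5: move `aj_c` across the linear equivalences (ABEL)
    have hcomp : (Θ₀.classPullback ((𝒥.abelJacobi c).left ≫ ψ)).LinEquiv
        ((Θ₀.pullback (𝒥.J.translation (x₁⁻¹ * x)).left).classPullback (𝒥.abelJacobi c).left) :=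
      (Θ₀.classPullback_comp_linEquiv ψ (𝒥.abelJacobi c).left).trans
        (((Θ₀.classPullback_linEquiv_pullback ψ).trans hL.linEquiv).classPullback _)
    have hcomp' : ((Θ.pullback (𝒥.J.translation x).left).classPullback (𝒥.abelJacobi c).left).LinEquiv
        ((Θ₀.pullback (𝒥.J.translation (x₁⁻¹ * x)).left).classPullback (𝒥.abelJacobi c).left) :=
      hR.linEquiv.classPullback _
    rw [hA hcomp', ← hA hcomp]
    change 𝒥.ajSum c (Θ₀.classPullback ((𝒥.abelJacobi c).left ≫ ψ)) = (x₁ * κ) * x⁻¹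
    rw [hψ, hmain, ha, mul_comm]

/-! ## §3 `K(Θ)(ℂ) = ⊥` -/

/-- **`K(Θ)(ℂ) = ⊥` FOR A RIEMANN THETA DIVISOR OF MULTIPLICITY ONE** (the «`φ_Θ` is injective» half of Riemann's theorem, with no
polarisation hypothesis): from Step I (§2) on a dense open set, Cor. 4.4.5 «`aj_c(α_c^♮ D^Θ_u) = u⁻¹`» holds for EVERY `u ∈ J(ℂ)` (★
`AbelianVariety.aj_classPullback_weilDiv_eq_inv_of_translate`), and `D^Θ_u ∼ 0` then forces `u = 1` (★
`AbelianVariety.KTheta_eq_bot_of_aj_classPullback_weilDiv_eq_inv`). [cite: Lange2023AbelianVarietiesComplex, §4.4.2 Cor. 4.4.5]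
[cite: Milne1986JacobianVarieties, §6 Thm. 6.6 and Lemma 6.9] -/
theorem KTheta_eq_bot_of_isRiemannThetaDivisor_of_forall_eq_one (hC : IsSmoothProjective 1 C) (𝒥 : Jacobian C)
    (c : AlgPoints C ℂ) (hA : ∀ {E F : CartierDivisor C.left}, E.LinEquiv F → 𝒥.ajSum c E = 𝒥.ajSum c F)
    {Θ : CartierDivisor 𝒥.J.X.left} (h1 : 𝒥.IsRiemannThetaDivisor Θ)
    (hone : ∀ (E : CartierDivisor 𝒥.J.X.left) (m : ℕ), E.IsEffective → 0 < m → Θ.SameDivisor (m • E) → m = 1) :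
    𝒥.J.KTheta Θ = ⊥ := by
  haveI := hC.smoothOfRelativeDimension
  haveI : IsProper C.hom := IsSmoothProjective.isProper_holds hC
  obtain ⟨U, hU, κ', hStepI⟩ := exists_open_ajSum_classPullback_translate_of_forall_eq_one hC 𝒥 c hA h1 hone
  exact AbelianVariety.KTheta_eq_bot_of_aj_classPullback_weilDiv_eq_inv (𝒥.abelJacobi c).left (𝒥.ajSum c)
    (fun D E h => hA h) Θ
    (AbelianVariety.aj_classPullback_weilDiv_eq_inv_of_translate (𝒥.abelJacobi c).left (𝒥.ajSum c) (𝒥.ajSum_add c)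
      (fun D E h => hA h) Θ hU κ' hStepI)

/-! ## §4 The letter `stub_V7b` of G5: `Z(Θ)` integral, ABEL from the tree -/

/-- **LETTER (V7-b) OF G5 (sockets v1, token for token): Step I for a Riemann theta divisor with `Z(Θ)` INTEGRAL.**  `Z(Θ)` integral ⇒
reduced ⇒ `Θ` has multiplicity one (★ `AbelianVariety.eq_one_of_sameDivisor_smul_of_isReduced`, the support of a Riemann theta divisor being
irreducible ★ `IsRiemannThetaDivisor.isIrreducible_support`), and ABEL at `c` is ★ `Jacobian.ajSum_congr_linEquiv`; so §2 applies.
[cite: Lange2023AbelianVarietiesComplex, §4.4.2 Lemma 4.4.4 (p. 224)] [cite: Milne1986JacobianVarieties, §6 Lemma 6.7 (p. 187)] -/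
theorem exists_open_ajSum_classPullback_translate_of_isIntegral (𝒥 : Jacobian C) (hC : IsSmoothProjective 1 C) (c : AlgPoints C ℂ)
    {Θ : CartierDivisor 𝒥.J.X.left} (h1 : 𝒥.IsRiemannThetaDivisor Θ) (hZ : IsIntegral h1.isEffective.idealSheaf.subscheme) :
    ∃ U : 𝒥.J.X.left.Opens, (U : Set 𝒥.J.X.left).Nonempty ∧ ∃ κ : 𝒥.J.Points ℂ,
      ∀ x : 𝒥.J.Points ℂ, x.pt ∈ U →
        𝒥.ajSum c ((Θ.pullback (𝒥.J.translation x).left).classPullback (𝒥.abelJacobi c).left) = κ * x⁻¹ := by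
  haveI := hC.smoothOfRelativeDimension
  haveI : IsProper C.hom := IsSmoothProjective.isProper_holds hC
  haveI : IsReduced h1.isEffective.idealSheaf.subscheme := inferInstance
  exact exists_open_ajSum_classPullback_translate_of_forall_eq_one hC 𝒥 c (fun h => 𝒥.ajSum_congr_linEquiv c h) h1
    (fun E m hE hm hs => 𝒥.J.eq_one_of_sameDivisor_smul_of_isReduced h1.isEffective (h1.isIrreducible_support hC) hE hm hs)

/-- **`K(Θ)(ℂ) = ⊥` for a Riemann theta divisor with `Z(Θ)` integral** (e.g. the prime theta divisor `[W̃_{g−1}]` of ★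
`Motives/JacobianPrimeThetaDivisor`) — no polarisation hypothesis, ABEL from the tree.
[cite: Lange2023AbelianVarietiesComplex, §4.4.2 Cor. 4.4.5] [cite: Milne1986JacobianVarieties, §6 Thm. 6.6 and Lemma 6.9] -/
theorem KTheta_eq_bot_of_isRiemannThetaDivisor_of_isIntegral (𝒥 : Jacobian C) (hC : IsSmoothProjective 1 C) (c : AlgPoints C ℂ)
    {Θ : CartierDivisor 𝒥.J.X.left} (h1 : 𝒥.IsRiemannThetaDivisor Θ) (hZ : IsIntegral h1.isEffective.idealSheaf.subscheme) :
    𝒥.J.KTheta Θ = ⊥ := by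
  haveI := hC.smoothOfRelativeDimension
  haveI : IsProper C.hom := IsSmoothProjective.isProper_holds hC
  haveI : IsReduced h1.isEffective.idealSheaf.subscheme := inferInstance
  exact KTheta_eq_bot_of_isRiemannThetaDivisor_of_forall_eq_one hC 𝒥 c (fun h => 𝒥.ajSum_congr_linEquiv c h) h1
    (fun E m hE hm hs => 𝒥.J.eq_one_of_sameDivisor_smul_of_isReduced h1.isEffective (h1.isIrreducible_support hC) hE hm hs)

end Jacobian

end Literature.AlgebraicGeometry.Motives

end
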